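import Literature.NumberTheory.Automorphic.CompactCoreLevelConj
import Literature.NumberTheory.Automorphic.LocalUnitaryGroupCongrMeasure
import Literature.NumberTheory.Rogawski1990.LocalTransferTransportCanonical
import Literature.NumberTheory.Rogawski1990.RegularEltLocalisation
import HarnessLib

/-!
# `∃ S₀, IsNormalisedOff` for families that are canonical and `vol K_v = 1`-normalised only OFF A FINITE SET, and the
# transported family `mq v := (ψ_v)_* mG v` of the quasi-split group
(Rogawski (1990), §4.3 pp. 43–44 «measures normalised so that `K ∩ T` has measure one for almost all `v`»; §14.2 p. 232 «we fix an
inner isomorphism `ψ : G′ → G` … if `v ∉ S`, (14.2.1) is obviously satisfied»; Gelbart (1975), §10 pp. 154–155)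

Topic `NumberTheory/Automorphic`; namespace `Literature.NumberTheory.Automorphic.UnitaryGroup` (sequel of ★ `CompactCoreLevelConj`, ★
`LocalUnitaryGroupCongrMeasure`, ★ `Rogawski1990/LocalTransferTransportCanonical`).  THEOREMS ONLY: no definition, no named fact, no
instance, no `sorry`.  Cell `pub/hodgecm-mathlib`, ENGINE T1 (crux item stmt-HodgeConjecture-24833), F0P3a row (MQ) «transport census →
brick» (GO #84): the ED 1.19c family of the quasi-split group `G = U(Φ₃)` is DERIVED, place by place, from the inner form's:
`ComparisonKit.mq v := (𝔨.mG v).transport (𝔨.ψ v).toMulEquiv (𝔨.ψ v).continuous (𝔨.ψ v).symm.continuous` (★ `OrbitalMeasureFamily.transport`).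
What transports along `ψ_v` is ★ already: the orbital integrals (★ `classOrbitalIntegral_transport`), admissibility and (14.2.1)
(★ `isAdmissibleOn_and_isLocalInnerTransfer_transport`), canonicity for `ν = (ψ_v)_* ν′` (★ `OrbitalMeasureFamily.IsCanonical.transport`, CM
dress ★ `transport_isCanonical_isRegularElt`), and the RAW normalisation transport (★ `isNormalisedOff_transport`).  The normalisation
`∃ S₀, IsNormalisedOff …` of the adelic family `ofLocalAdelic mq mqi` (the `hnorm` antecedents of ★ E3c
`MatchingAdeleG.exists_isEulerOnClasses_ofLocalAdelic`) comes, for CANONICAL families, from ★ `CompactCoreLevelConj` §2–§3 — but those four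
theorems ask `vol K_v = 1` AND canonicity AT EVERY `v`, and for `mq` the pair holds only OFF the level-matching set `S₀` of (Ψ⁺) ★
`exists_psi_corresponds_forall_levelMatching`: with the `vol U(Φ₃)(𝒪_v) = 1`-normalised `νq v` one has `νq v = (νG v).map (ψ v)` exactly when
`ψ_v` matches the levels (★ `measurePreserving_of_cmLocalIntegralLevel_iff`), and at `v ∈ S₀` the two differ by a Haar scalar.  Since
`IsNormalisedOff … S₀` only reads places off `S₀`, the hypotheses can be weakened to «off a finite set `S₁`» at no cost — that is this file.

* §1 (`U(H)`, any `N`, `H`; hypotheses `vol K_v = 1`, canonical, `P_v (out ⟦y_v⟧)` asked only for `v ∉ S₁`)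
  `UnitaryGroup.exists_isNormalisedOff_of_isCanonical_off` (any adelic `y` with a.e.-small compact cores),
  `UnitaryGroup.exists_isNormalisedOff_conj_off` (every adelic conjugate `a y a⁻¹`),
  `UnitaryGroup.exists_isNormalisedOff_of_isConj_toAdelic_off` (every adelic conjugate of a regular rational `γ`, under ★
  `CompactCoreCentralizerLevelAE`) — the ★ §2 chain verbatim with `S₁ ∪ ·` as the exceptional set.
* §2 (`G = U(Φ₃)`) `UnitaryGroup.exists_isNormalisedOff_matchingAdeleG_off` — ★ §3 with the same weakening: every matching adèle
  `p ∈ 𝒪_st(γ₀ ∕ 𝐀)` over a regular rational `γ₀ ∈ U(H)(L⁺)` (★ `MatchingAdeleGEventuallyKConj`, ★ `CompactCoreCentralizerLevelAE L 3 Φ₃`).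
* §3 (the `mq` dress, `N = 3`; hypotheses ONLY on the inner form `U(H)` and on `ψ`: `mG v` canonical on the regular classes for `νG v` with
  `νG v (U(H)(𝒪_v)) = 1` at every `v` — the kit's guard `hK` and pin `canonical` —, `ψ_v⁻¹ γ ↔ γ`, level matching `∀ v ∉ S₀`, and a normalised
  `νq` on `U(Φ₃)(L⁺_v)` — it exists, ★ `exists_isHaarMeasure_cmLocalIntegralLevel_eq_one`):
  `UnitaryGroup.transport_isCanonical_of_levelMatching` — `∀ v ∉ S₀`, `mq v` is canonical on the regular classes for `νq v`;
  **`UnitaryGroup.exists_isNormalisedOff_transport_of_isConj_toAdelic`** — `∃ S₁, IsNormalisedOff L 3 Φ₃ mq y S₁` at every adelic conjugate `y`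
  of a regular rational `γ ∈ U(Φ₃)(L⁺)`; **`UnitaryGroup.exists_isNormalisedOff_transport_matchingAdeleG`** — the same at every matching adèle
  `p ∈ 𝒪_st(γ₀ ∕ 𝐀)`, `γ₀ ∈ U(H)(L⁺)` regular (the regularity of the local class representatives is DISCHARGED here, ★
  `isRegularElt_toLocal_toAdelic` ∕ `isRegularElt_out_mk_local`); and the two `∃`-shaped antecedents `hnormγ`, `hnorm` of ★ E3c
  VERBATIM for `mq`: `UnitaryGroup.exists_isNormalisedOff_transport_toAdelic`, `UnitaryGroup.forall_exists_isNormalisedOff_transport_matchingAdeleG`.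
HC_CM is proved only modulo the printed citations until rung 0 closes; this file is unconditional.

## References
* [Rogawski1990] J. D. Rogawski, *Automorphic Representations of Unitary Groups in Three Variables*, Ann. of Math. Stud. 123 (1990), §3.3
  p. 21, §4.3 pp. 43–44, §14.2 (14.2.1) p. 232.
* [Kottwitz1986] R. Kottwitz, *Stable trace formula: elliptic singular terms*, Math. Ann. 275 (1986), Prop. 7.1.
* [Gelbart1975] S. Gelbart, *Automorphic forms on adele groups*, Ann. of Math. Stud. 83 (1975), §10 pp. 154–155.
-/

set_option autoImplicit false

noncomputable section

open MeasureTheory Measure Set NumberField IsDedekindDomain Filter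
open Literature.MeasureTheory.Group
open scoped ENNReal NNReal

namespace Literature.NumberTheory.Automorphic

namespace UnitaryGroup

/-! ## §1 `∃ S₀, IsNormalisedOff` when `vol K_v = 1` and canonicity hold only off a finite set `S₁` -/

section OffFinset

variable (L : Type) [Field L] [NumberField L] [IsCMField L] (N : ℕ) (H : Matrix (Fin N) (Fin N) L)
  [∀ (v : HeightOneSpectrum (𝓞 ↥(maximalRealSubfield L))) (x : (cmDatum L N H).Local v),
    MeasurableSpace ((cmDatum L N H).Local v ⧸ Subgroup.centralizer ({x} : Set ((cmDatum L N H).Local v)))]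
  [∀ (v : HeightOneSpectrum (𝓞 ↥(maximalRealSubfield L))) (x : (cmDatum L N H).Local v),
    BorelSpace ((cmDatum L N H).Local v ⧸ Subgroup.centralizer ({x} : Set ((cmDatum L N H).Local v)))]
  [∀ v : HeightOneSpectrum (𝓞 ↥(maximalRealSubfield L)), MeasurableSpace ((cmDatum L N H).Local v)]
  [∀ v : HeightOneSpectrum (𝓞 ↥(maximalRealSubfield L)), BorelSpace ((cmDatum L N H).Local v)]
  [∀ v : HeightOneSpectrum (𝓞 ↥(maximalRealSubfield L)), SecondCountableTopology ((cmDatum L N H).Local v)]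
  (P : ∀ v : HeightOneSpectrum (𝓞 ↥(maximalRealSubfield L)), (cmDatum L N H).Local v → Prop)
  (νG : ∀ v : HeightOneSpectrum (𝓞 ↥(maximalRealSubfield L)), Measure ((cmDatum L N H).Local v))
  [∀ v, (νG v).IsHaarMeasure] [∀ v, (νG v).IsMulRightInvariant]
  (mG : ∀ v : HeightOneSpectrum (𝓞 ↥(maximalRealSubfield L)), OrbitalMeasureFamily ((cmDatum L N H).Local v))
  (S₁ : Finset (HeightOneSpectrum (𝓞 ↥(maximalRealSubfield L))))

/-- **Normalised off a finite set at ANY adelic point with a.e.-small compact cores — hypotheses OFF `S₁` only**: local families `mG v`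
canonical for `(P_v, ν_v)` and `ν_v(K_v) = 1` for `v ∉ S₁`; an adelic `y` with `P_v (out ⟦y_v⟧)` for `v ∉ S₁` and `compactCore Z(y_v) ⊆ K_v`
for almost all `v` is normalised off a finite set: `∃ S₀, IsNormalisedOff L N H mG y S₀` (`S₀ := S₁ ∪` the exceptional cofinite complement;
★ `IsCanonical.atPoint_image_mk_eq_one` place by place).  ★ `exists_isNormalisedOff_of_eventually` is the case `S₁ = ∅`.
[cite: Rogawski1990, §4.3 (p. 43)] -/
theorem exists_isNormalisedOff_of_isCanonical_off (hν : ∀ v, v ∉ S₁ → νG v (cmLocalIntegralLevel L N H v) = 1)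
    (hcan : ∀ v, v ∉ S₁ → (mG v).IsCanonical (P v) (νG v)) (y : (cmDatum L N H).Adelic)
    (hP : ∀ v, v ∉ S₁ → P v (Quotient.out (ConjClasses.mk ((cmDatum L N H).toLocal v y))))
    (hcc : ∀ᶠ v in cofinite, compactCore (Subgroup.centralizer ({(cmDatum L N H).toLocal v y} : Set ((cmDatum L N H).Local v))) ⊆
      Subtype.val ⁻¹' (cmLocalIntegralLevel L N H v : Set ((cmDatum L N H).Local v))) :
    ∃ S₀ : Finset (HeightOneSpectrum (𝓞 ↥(maximalRealSubfield L))), IsNormalisedOff L N H mG y S₀ := by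
  classical
  rw [Filter.eventually_cofinite] at hcc
  refine ⟨S₁ ∪ hcc.toFinset, fun v hv => ?_⟩
  rw [Finset.mem_union, not_or] at hv
  have hv' : compactCore (Subgroup.centralizer ({(cmDatum L N H).toLocal v y} : Set ((cmDatum L N H).Local v))) ⊆
      Subtype.val ⁻¹' (cmLocalIntegralLevel L N H v : Set ((cmDatum L N H).Local v)) := by
    by_contra hnot
    exact hv.2 (hcc.mem_toFinset.2 hnot)
  obtain ⟨hKc, hKo⟩ := isCompact_isOpen_cmLocalIntegralLevel L N H v
  exact (hcan v hv.1).atPoint_image_mk_eq_one _ (hP v hv.1) (cmLocalIntegralLevel L N H v) hKo hKc (hν v hv.1) hv'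

/-- **Normalised at every adelic CONJUGATE — hypotheses off `S₁`**: if the compact cores at `y` are a.e. in `K_v`, then so are those at
`a y a⁻¹` for EVERY adelic `a` (`a_v ∈ K_v` for almost all `v`, ★ `eventually_toLocal_mem_cmLocalIntegralLevel`; ★
`compactCore_centralizer_conj_subset`), hence `∃ S₀, IsNormalisedOff L N H mG (a * y * a⁻¹) S₀`.
[cite: Rogawski1990, §4.3 (p. 43)] -/
theorem exists_isNormalisedOff_conj_off (hν : ∀ v, v ∉ S₁ → νG v (cmLocalIntegralLevel L N H v) = 1)
    (hcan : ∀ v, v ∉ S₁ → (mG v).IsCanonical (P v) (νG v)) (y a : (cmDatum L N H).Adelic)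
    (hP : ∀ v, v ∉ S₁ → P v (Quotient.out (ConjClasses.mk ((cmDatum L N H).toLocal v (a * y * a⁻¹)))))
    (hcc : ∀ᶠ v in cofinite, compactCore (Subgroup.centralizer ({(cmDatum L N H).toLocal v y} : Set ((cmDatum L N H).Local v))) ⊆
      Subtype.val ⁻¹' (cmLocalIntegralLevel L N H v : Set ((cmDatum L N H).Local v))) :
    ∃ S₀ : Finset (HeightOneSpectrum (𝓞 ↥(maximalRealSubfield L))), IsNormalisedOff L N H mG (a * y * a⁻¹) S₀ := by
  refine exists_isNormalisedOff_of_isCanonical_off L N H P νG mG S₁ hν hcan (a * y * a⁻¹) hP ?_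
  filter_upwards [hcc, Rogawski1990.eventually_toLocal_mem_cmLocalIntegralLevel a] with v hv ha
  rw [map_mul, map_mul, map_inv]
  exact compactCore_centralizer_conj_subset (cmLocalIntegralLevel L N H v) _ _ ha hv

/-- **Normalised at every adelic conjugate of a regular RATIONAL point — hypotheses off `S₁`**, under the named fact ★
`CompactCoreCentralizerLevelAE L N H` (F4-a): for `γ ∈ U(H)(L⁺)` regular and any adelic `y` conjugate to `toAdelic γ` in `U(H)(𝔸)`,
`∃ S₀, IsNormalisedOff L N H mG y S₀`.  ★ `exists_isNormalisedOff_of_isConj_toAdelic` is the case `S₁ = ∅`.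
[cite: Rogawski1990, §4.3 (p. 43)] -/
theorem exists_isNormalisedOff_of_isConj_toAdelic_off (hν : ∀ v, v ∉ S₁ → νG v (cmLocalIntegralLevel L N H v) = 1)
    (hcan : ∀ v, v ∉ S₁ → (mG v).IsCanonical (P v) (νG v)) (hF : CompactCoreCentralizerLevelAE L N H)
    (γ : (cmDatum L N H).Rational) (hγ : Rogawski1990.IsRegularElt (γ.val : GL (Fin N) L)) (y : (cmDatum L N H).Adelic)
    (hy : IsConj ((cmDatum L N H).toAdelic γ) y)
    (hP : ∀ v, v ∉ S₁ → P v (Quotient.out (ConjClasses.mk ((cmDatum L N H).toLocal v y)))) :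
    ∃ S₀ : Finset (HeightOneSpectrum (𝓞 ↥(maximalRealSubfield L))), IsNormalisedOff L N H mG y S₀ := by
  obtain ⟨a, ha⟩ := isConj_iff.1 hy
  subst ha
  exact exists_isNormalisedOff_conj_off L N H P νG mG S₁ hν hcan _ a hP (hF γ hγ)

end OffFinset

/-! ## §2 (`G = U(Φ₃)`) `∃ S₀, IsNormalisedOff` at every MATCHING ADÈLE — hypotheses off `S₁` -/

section MatchingAdele

variable (L : Type) [Field L] [NumberField L] [IsCMField L] (H : Matrix (Fin 3) (Fin 3) L)
  [∀ (v : HeightOneSpectrum (𝓞 ↥(maximalRealSubfield L)))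
    (x : (cmDatum L 3 (Matrix.of fun i j : Fin 3 => if i.val + j.val + 1 = 3 then (1 : L) else 0)).Local v),
    MeasurableSpace ((cmDatum L 3 (Matrix.of fun i j : Fin 3 => if i.val + j.val + 1 = 3 then (1 : L) else 0)).Local v ⧸
      Subgroup.centralizer ({x} : Set ((cmDatum L 3 (Matrix.of fun i j : Fin 3 => if i.val + j.val + 1 = 3 then (1 : L) else 0)).Local v)))]
  [∀ (v : HeightOneSpectrum (𝓞 ↥(maximalRealSubfield L)))
    (x : (cmDatum L 3 (Matrix.of fun i j : Fin 3 => if i.val + j.val + 1 = 3 then (1 : L) else 0)).Local v),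
    BorelSpace ((cmDatum L 3 (Matrix.of fun i j : Fin 3 => if i.val + j.val + 1 = 3 then (1 : L) else 0)).Local v ⧸
      Subgroup.centralizer ({x} : Set ((cmDatum L 3 (Matrix.of fun i j : Fin 3 => if i.val + j.val + 1 = 3 then (1 : L) else 0)).Local v)))]
  [∀ v : HeightOneSpectrum (𝓞 ↥(maximalRealSubfield L)),
    MeasurableSpace ((cmDatum L 3 (Matrix.of fun i j : Fin 3 => if i.val + j.val + 1 = 3 then (1 : L) else 0)).Local v)]
  [∀ v : HeightOneSpectrum (𝓞 ↥(maximalRealSubfield L)),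
    BorelSpace ((cmDatum L 3 (Matrix.of fun i j : Fin 3 => if i.val + j.val + 1 = 3 then (1 : L) else 0)).Local v)]
  [∀ v : HeightOneSpectrum (𝓞 ↥(maximalRealSubfield L)),
    SecondCountableTopology ((cmDatum L 3 (Matrix.of fun i j : Fin 3 => if i.val + j.val + 1 = 3 then (1 : L) else 0)).Local v)]
  (P : ∀ v : HeightOneSpectrum (𝓞 ↥(maximalRealSubfield L)),
    (cmDatum L 3 (Matrix.of fun i j : Fin 3 => if i.val + j.val + 1 = 3 then (1 : L) else 0)).Local v → Prop)
  (ν : ∀ v : HeightOneSpectrum (𝓞 ↥(maximalRealSubfield L)),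
    Measure ((cmDatum L 3 (Matrix.of fun i j : Fin 3 => if i.val + j.val + 1 = 3 then (1 : L) else 0)).Local v))
  [∀ v, (ν v).IsHaarMeasure] [∀ v, (ν v).IsMulRightInvariant]
  (m : ∀ v : HeightOneSpectrum (𝓞 ↥(maximalRealSubfield L)),
    OrbitalMeasureFamily ((cmDatum L 3 (Matrix.of fun i j : Fin 3 => if i.val + j.val + 1 = 3 then (1 : L) else 0)).Local v))
  (S₁ : Finset (HeightOneSpectrum (𝓞 ↥(maximalRealSubfield L))))

/-- **Normalised at every matching adèle of the quasi-split group — hypotheses off `S₁`.**  `m v` local families on `U(Φ₃)(L⁺_v)`,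
canonical for `(P_v, ν_v)` with `ν_v(U(Φ₃)(𝒪_v)) = 1` FOR `v ∉ S₁`; named facts ★ `MatchingAdeleGEventuallyKConj L H` ([Kt₄] Prop. 7.1 in
print's `K_v`-form) and ★ `CompactCoreCentralizerLevelAE L 3 Φ₃`; `γ₀ ∈ U(H)(L⁺)` regular with a rational correspondent `γ ∈ U(Φ₃)(L⁺)`.
Then EVERY `p ∈ 𝒪_st(γ₀ ∕ 𝐀) ⊂ U(Φ₃)(𝐀)` (★ `MatchingAdeleG`) with `P_v` at its local class representatives for `v ∉ S₁` is normalised off a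
finite set (for almost all `v`: `p_v ∈ K_v`, so `p_v = k γ_v k⁻¹` with `k ∈ K_v`, so `compactCore Z(p_v) ⊆ K_v`; then §1).  ★
`exists_isNormalisedOff_matchingAdeleG` is the case `S₁ = ∅`. [cite: Rogawski1990, §3.3 p. 21; §4.3 (pp. 43–44)] [cite: Kottwitz1986, Prop. 7.1] -/
theorem exists_isNormalisedOff_matchingAdeleG_off
    (hν : ∀ v, v ∉ S₁ → ν v (cmLocalIntegralLevel L 3 (Matrix.of fun i j : Fin 3 => if i.val + j.val + 1 = 3 then (1 : L) else 0) v) = 1)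
    (hcan : ∀ v, v ∉ S₁ → (m v).IsCanonical (P v) (ν v))
    (hK : Rogawski1990.MatchingAdeleGEventuallyKConj L H)
    (hF : CompactCoreCentralizerLevelAE L 3 (Matrix.of fun i j : Fin 3 => if i.val + j.val + 1 = 3 then (1 : L) else 0))
    {γ₀ : (cmDatum L 3 H).Rational} (hreg : Rogawski1990.IsRegularElt (γ₀.val : GL (Fin 3) L))
    {γ : (cmDatum L 3 (Matrix.of fun i j : Fin 3 => if i.val + j.val + 1 = 3 then (1 : L) else 0)).Rational}
    (hγ : Rogawski1990.Corresponds (cmConjRingHom L) H (Matrix.of fun i j : Fin 3 => if i.val + j.val + 1 = 3 then (1 : L) else 0) γ₀ γ)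
    (p : Rogawski1990.MatchingAdeleG L H γ₀)
    (hP : ∀ v, v ∉ S₁ → P v (Quotient.out (ConjClasses.mk
      ((cmDatum L 3 (Matrix.of fun i j : Fin 3 => if i.val + j.val + 1 = 3 then (1 : L) else 0)).toLocal v p.adele)))) :
    ∃ S₀ : Finset (HeightOneSpectrum (𝓞 ↥(maximalRealSubfield L))),
      IsNormalisedOff L 3 (Matrix.of fun i j : Fin 3 => if i.val + j.val + 1 = 3 then (1 : L) else 0) m p.adele S₀ := by
  refine exists_isNormalisedOff_of_isCanonical_off L 3 _ P ν m S₁ hν hcan p.adele hP ?_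
  have hγreg : Rogawski1990.IsRegularElt (γ.val : GL (Fin 3) L) := Rogawski1990.isRegularElt_of_isConj hγ hreg
  filter_upwards [hK.eventually_forall_exists_conj hreg hγ, Rogawski1990.eventually_toLocal_mem_cmLocalIntegralLevel p.adele, hF γ hγreg]
    with v hv hint hcc
  obtain ⟨k, hk, hkp⟩ := hv p hint
  rw [← hkp]
  exact compactCore_centralizer_conj_subset _ _ k hk hcc

end MatchingAdele

/-! ## §3 The `mq` dress: `mq v := (ψ_v)_* mG v` is canonical for the normalised `νq v` off `S₀`, hence normalised off a finite set -/

section Transport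

variable (L : Type) [Field L] [NumberField L] [IsCMField L] (H : Matrix (Fin 3) (Fin 3) L)
  -- Borel structures on the local groups of the inner form `U(H)` and on their orbit quotients
  [∀ v : HeightOneSpectrum (𝓞 ↥(maximalRealSubfield L)), MeasurableSpace ((cmDatum L 3 H).Local v)]
  [∀ v : HeightOneSpectrum (𝓞 ↥(maximalRealSubfield L)), BorelSpace ((cmDatum L 3 H).Local v)]
  [∀ (v : HeightOneSpectrum (𝓞 ↥(maximalRealSubfield L))) (x : (cmDatum L 3 H).Local v),
    MeasurableSpace ((cmDatum L 3 H).Local v ⧸ Subgroup.centralizer ({x} : Set ((cmDatum L 3 H).Local v)))]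
  [∀ (v : HeightOneSpectrum (𝓞 ↥(maximalRealSubfield L))) (x : (cmDatum L 3 H).Local v),
    BorelSpace ((cmDatum L 3 H).Local v ⧸ Subgroup.centralizer ({x} : Set ((cmDatum L 3 H).Local v)))]
  -- the same for the quasi-split group `U(Φ₃)`
  [∀ v : HeightOneSpectrum (𝓞 ↥(maximalRealSubfield L)),
    MeasurableSpace ((cmDatum L 3 (Matrix.of fun i j : Fin 3 => if i.val + j.val + 1 = 3 then (1 : L) else 0)).Local v)]
  [∀ v : HeightOneSpectrum (𝓞 ↥(maximalRealSubfield L)),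
    BorelSpace ((cmDatum L 3 (Matrix.of fun i j : Fin 3 => if i.val + j.val + 1 = 3 then (1 : L) else 0)).Local v)]
  [∀ v : HeightOneSpectrum (𝓞 ↥(maximalRealSubfield L)),
    SecondCountableTopology ((cmDatum L 3 (Matrix.of fun i j : Fin 3 => if i.val + j.val + 1 = 3 then (1 : L) else 0)).Local v)]
  [∀ (v : HeightOneSpectrum (𝓞 ↥(maximalRealSubfield L)))
    (x : (cmDatum L 3 (Matrix.of fun i j : Fin 3 => if i.val + j.val + 1 = 3 then (1 : L) else 0)).Local v),
    MeasurableSpace ((cmDatum L 3 (Matrix.of fun i j : Fin 3 => if i.val + j.val + 1 = 3 then (1 : L) else 0)).Local v ⧸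
      Subgroup.centralizer ({x} : Set ((cmDatum L 3 (Matrix.of fun i j : Fin 3 => if i.val + j.val + 1 = 3 then (1 : L) else 0)).Local v)))]
  [∀ (v : HeightOneSpectrum (𝓞 ↥(maximalRealSubfield L)))
    (x : (cmDatum L 3 (Matrix.of fun i j : Fin 3 => if i.val + j.val + 1 = 3 then (1 : L) else 0)).Local v),
    BorelSpace ((cmDatum L 3 (Matrix.of fun i j : Fin 3 => if i.val + j.val + 1 = 3 then (1 : L) else 0)).Local v ⧸
      Subgroup.centralizer ({x} : Set ((cmDatum L 3 (Matrix.of fun i j : Fin 3 => if i.val + j.val + 1 = 3 then (1 : L) else 0)).Local v)))]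
  -- the local congruences `ψ_v : U(H)(L⁺_v) ≃ₜ* U(Φ₃)(L⁺_v)`, class-preserving backwards, level matching off `S₀`
  (ψ : ∀ v : HeightOneSpectrum (𝓞 ↥(maximalRealSubfield L)), (cmDatum L 3 H).Local v ≃ₜ*
    (cmDatum L 3 (Matrix.of fun i j : Fin 3 => if i.val + j.val + 1 = 3 then (1 : L) else 0)).Local v)
  (hcorr' : ∀ v (γ : (cmDatum L 3 (Matrix.of fun i j : Fin 3 => if i.val + j.val + 1 = 3 then (1 : L) else 0)).Local v),
    Rogawski1990.Corresponds (conjLocal L (IsCMField.complexConj L) v) ((adelicForm L 3 H).map (adeleToLocal L v))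
      ((adelicForm L 3 (Matrix.of fun i j : Fin 3 => if i.val + j.val + 1 = 3 then (1 : L) else 0)).map (adeleToLocal L v))
      ((ψ v).symm γ) γ)
  (S₀ : Finset (HeightOneSpectrum (𝓞 ↥(maximalRealSubfield L))))
  (hψK : ∀ v, v ∉ S₀ → ∀ g, ψ v g ∈ cmLocalIntegralLevel L 3 (Matrix.of fun i j : Fin 3 => if i.val + j.val + 1 = 3 then (1 : L) else 0) v ↔
    g ∈ cmLocalIntegralLevel L 3 H v)
  -- the local Haar measures: `νG` on the inner form (the kit's parameter, guard `hK`), a normalised `νq` on `U(Φ₃)`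
  (νG : ∀ v : HeightOneSpectrum (𝓞 ↥(maximalRealSubfield L)), Measure ((cmDatum L 3 H).Local v))
  [∀ v, (νG v).IsHaarMeasure] [∀ v, (νG v).IsMulRightInvariant]
  (νq : ∀ v : HeightOneSpectrum (𝓞 ↥(maximalRealSubfield L)),
    Measure ((cmDatum L 3 (Matrix.of fun i j : Fin 3 => if i.val + j.val + 1 = 3 then (1 : L) else 0)).Local v))
  [∀ v, (νq v).IsHaarMeasure] [∀ v, (νq v).IsMulRightInvariant]
  (hK : ∀ v, νG v (cmLocalIntegralLevel L 3 H v) = 1)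
  (hKq : ∀ v, νq v (cmLocalIntegralLevel L 3 (Matrix.of fun i j : Fin 3 => if i.val + j.val + 1 = 3 then (1 : L) else 0) v) = 1)
  -- the inner form's local orbital measure families, canonical on the regular classes (the kit's pin `canonical`)
  {mG : ∀ v : HeightOneSpectrum (𝓞 ↥(maximalRealSubfield L)), OrbitalMeasureFamily ((cmDatum L 3 H).Local v)}
  (hcan : ∀ v, (mG v).IsCanonical (fun γ => Rogawski1990.IsRegularElt (γ.val : GL (Fin 3) (LocalRing L v))) (νG v))

include hcorr' hψK hK hKq hcan

/-- **`mq v := (ψ_v)_* mG v` is CANONICAL on the regular classes for the NORMALISED `νq v`, for every `v ∉ S₀`**: a level-matching `ψ_v` is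
measure preserving between the `vol K = 1`-normalised Haar measures (★ `measurePreserving_of_cmLocalIntegralLevel_iff`), so
`νq v = (νG v).map (ψ v)` and ★ `transport_isCanonical_isRegularElt` applies. [cite: Rogawski1990, §4.3 (4.3.1) p. 43; §14.2 p. 232] -/
theorem transport_isCanonical_of_levelMatching (v : HeightOneSpectrum (𝓞 ↥(maximalRealSubfield L))) (hv : v ∉ S₀) :
    ((mG v).transport (ψ v).toMulEquiv (ψ v).continuous (ψ v).symm.continuous).IsCanonical
      (fun γ => Rogawski1990.IsRegularElt (γ.val : GL (Fin 3) (LocalRing L v))) (νq v) :=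
  Rogawski1990.transport_isCanonical_isRegularElt L H v (ψ v) (hcorr' v) (νG v) (νq v)
    (measurePreserving_of_cmLocalIntegralLevel_iff L (ψ v) (hψK v hv) (νG v) (νq v) (hK v) (hKq v)).map_eq.symm (hcan v)

/-- **`mq` is normalised off a finite set at every adelic conjugate of a regular rational `γ ∈ U(Φ₃)(L⁺)`**, under ★
`CompactCoreCentralizerLevelAE L 3 Φ₃`: `∃ S₁, IsNormalisedOff L 3 Φ₃ mq y S₁` for every adelic `y` conjugate to `toAdelic γ` — the `hnormγ`
antecedent of ★ E3c for the measure data `ofLocalAdelic mq mqi` (§1 with `S₁ := S₀`; regularity of `out ⟦y_v⟧` from ★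
`isRegularElt_toLocal_toAdelic`, conjugation invariance ★ `isRegularElt_iff_of_isConj_local`, ★ `isRegularElt_out_mk_local`).
[cite: Rogawski1990, §4.3 (pp. 43–44); §14.2 p. 232] -/
theorem exists_isNormalisedOff_transport_of_isConj_toAdelic
    (hF : CompactCoreCentralizerLevelAE L 3 (Matrix.of fun i j : Fin 3 => if i.val + j.val + 1 = 3 then (1 : L) else 0))
    (γ : (cmDatum L 3 (Matrix.of fun i j : Fin 3 => if i.val + j.val + 1 = 3 then (1 : L) else 0)).Rational)
    (hγ : Rogawski1990.IsRegularElt (γ.val : GL (Fin 3) L))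
    (y : (cmDatum L 3 (Matrix.of fun i j : Fin 3 => if i.val + j.val + 1 = 3 then (1 : L) else 0)).Adelic)
    (hy : IsConj ((cmDatum L 3 (Matrix.of fun i j : Fin 3 => if i.val + j.val + 1 = 3 then (1 : L) else 0)).toAdelic γ) y) :
    ∃ S₁ : Finset (HeightOneSpectrum (𝓞 ↥(maximalRealSubfield L))),
      IsNormalisedOff L 3 (Matrix.of fun i j : Fin 3 => if i.val + j.val + 1 = 3 then (1 : L) else 0)
        (fun v => (mG v).transport (ψ v).toMulEquiv (ψ v).continuous (ψ v).symm.continuous) y S₁ := by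
  refine exists_isNormalisedOff_of_isConj_toAdelic_off L 3 _
    (fun v γ => Rogawski1990.IsRegularElt (γ.val : GL (Fin 3) (LocalRing L v))) νq
    (fun v => (mG v).transport (ψ v).toMulEquiv (ψ v).continuous (ψ v).symm.continuous) S₀ (fun v _ => hKq v)
    (fun v hv => transport_isCanonical_of_levelMatching L H ψ hcorr' S₀ hψK νG νq hK hKq hcan v hv) hF γ hγ y hy
    (fun v _ => Rogawski1990.isRegularElt_out_mk_local ?_)
  exact (Rogawski1990.isRegularElt_iff_of_isConj_local L _ v
    (((cmDatum L 3 (Matrix.of fun i j : Fin 3 => if i.val + j.val + 1 = 3 then (1 : L) else 0)).toLocal v).map_isConj hy)).1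
    (Rogawski1990.isRegularElt_toLocal_toAdelic L _ γ hγ v)

/-- **`mq` is normalised off a finite set at every MATCHING ADÈLE `p ∈ 𝒪_st(γ₀ ∕ 𝐀)`** over a regular rational `γ₀ ∈ U(H)(L⁺)` (with a rational
correspondent `γ ∈ U(Φ₃)(L⁺)` — one exists, ★ `exists_corresponds_antidiagThree_all`), under ★ `MatchingAdeleGEventuallyKConj L H` and ★
`CompactCoreCentralizerLevelAE L 3 Φ₃`: `∃ S₁, IsNormalisedOff L 3 Φ₃ mq p.adele S₁` — the `hnorm` antecedent of ★ E3c
`MatchingAdeleG.exists_isEulerOnClasses_ofLocalAdelic` for `ofLocalAdelic mq mqi` at EVERY class of the adelic stable class (§2 with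
`S₁ := S₀`; regularity of `out ⟦p_v⟧` discharged: `p_v ↔ (γ₀)_v`, ★ `isRegularElt_of_isConj`).
[cite: Rogawski1990, §3.3 p. 21; §4.3 (pp. 43–44); §14.2 p. 232] [cite: Kottwitz1986, Prop. 7.1] -/
theorem exists_isNormalisedOff_transport_matchingAdeleG
    (hKC : Rogawski1990.MatchingAdeleGEventuallyKConj L H)
    (hF : CompactCoreCentralizerLevelAE L 3 (Matrix.of fun i j : Fin 3 => if i.val + j.val + 1 = 3 then (1 : L) else 0))
    {γ₀ : (cmDatum L 3 H).Rational} (hreg : Rogawski1990.IsRegularElt (γ₀.val : GL (Fin 3) L))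
    {γ : (cmDatum L 3 (Matrix.of fun i j : Fin 3 => if i.val + j.val + 1 = 3 then (1 : L) else 0)).Rational}
    (hγ : Rogawski1990.Corresponds (cmConjRingHom L) H (Matrix.of fun i j : Fin 3 => if i.val + j.val + 1 = 3 then (1 : L) else 0) γ₀ γ)
    (p : Rogawski1990.MatchingAdeleG L H γ₀) :
    ∃ S₁ : Finset (HeightOneSpectrum (𝓞 ↥(maximalRealSubfield L))),
      IsNormalisedOff L 3 (Matrix.of fun i j : Fin 3 => if i.val + j.val + 1 = 3 then (1 : L) else 0)
        (fun v => (mG v).transport (ψ v).toMulEquiv (ψ v).continuous (ψ v).symm.continuous) p.adele S₁ :=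
  exists_isNormalisedOff_matchingAdeleG_off L H
    (fun v γ => Rogawski1990.IsRegularElt (γ.val : GL (Fin 3) (LocalRing L v))) νq
    (fun v => (mG v).transport (ψ v).toMulEquiv (ψ v).continuous (ψ v).symm.continuous) S₀ (fun v _ => hKq v)
    (fun v hv => transport_isCanonical_of_levelMatching L H ψ hcorr' S₀ hψK νG νq hK hKq hcan v hv) hKC hF hreg hγ p
    (fun v _ => Rogawski1990.isRegularElt_out_mk_local
      (Rogawski1990.isRegularElt_of_isConj (p.corresponds_toLocal v) (Rogawski1990.isRegularElt_toLocal_toAdelic L H γ₀ hreg v)))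

/-! ### The two `∃`-shaped antecedents of ★ E3c `MatchingAdeleG.exists_isEulerOnClasses_ofLocalAdelic`, VERBATIM for `mq` -/

/-- **`hnormγ` of ★ E3c for `mq`**: `∃ S₀, IsNormalisedOff L 3 Φ₃ mq (toAdelic γ) S₀` for the rational correspondent `γ ∈ U(Φ₃)(L⁺)` of a regular
`γ₀ ∈ U(H)(L⁺)` (E3c's binders `hreg`, `hγ`), under ★ `CompactCoreCentralizerLevelAE L 3 Φ₃` (the previous theorem at `y := toAdelic γ`).
[cite: Rogawski1990, §4.3 (pp. 43–44); §14.2 p. 232] -/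
theorem exists_isNormalisedOff_transport_toAdelic
    (hF : CompactCoreCentralizerLevelAE L 3 (Matrix.of fun i j : Fin 3 => if i.val + j.val + 1 = 3 then (1 : L) else 0))
    {γ₀ : (cmDatum L 3 H).Rational} (hreg : Rogawski1990.IsRegularElt (γ₀.val : GL (Fin 3) L))
    {γ : (cmDatum L 3 (Matrix.of fun i j : Fin 3 => if i.val + j.val + 1 = 3 then (1 : L) else 0)).Rational}
    (hγ : Rogawski1990.Corresponds (cmConjRingHom L) H (Matrix.of fun i j : Fin 3 => if i.val + j.val + 1 = 3 then (1 : L) else 0) γ₀ γ) :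
    ∃ S₁ : Finset (HeightOneSpectrum (𝓞 ↥(maximalRealSubfield L))),
      IsNormalisedOff L 3 (Matrix.of fun i j : Fin 3 => if i.val + j.val + 1 = 3 then (1 : L) else 0)
        (fun v => (mG v).transport (ψ v).toMulEquiv (ψ v).continuous (ψ v).symm.continuous)
        ((cmDatum L 3 (Matrix.of fun i j : Fin 3 => if i.val + j.val + 1 = 3 then (1 : L) else 0)).toAdelic γ) S₁ :=
  exists_isNormalisedOff_transport_of_isConj_toAdelic L H ψ hcorr' S₀ hψK νG νq hK hKq hcan hF γ
    (Rogawski1990.isRegularElt_of_isConj hγ hreg) _ (IsConj.refl _)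

/-- **`hnorm` of ★ E3c for `mq`**: `∀ p : MatchingAdeleG L H γ₀, ∃ S₀, IsNormalisedOff L 3 Φ₃ mq p.adele S₀` (E3c's binders `hKC`, `hreg`, `hγ`),
under ★ `CompactCoreCentralizerLevelAE L 3 Φ₃`. [cite: Rogawski1990, §3.3 p. 21; §4.3 (pp. 43–44)] [cite: Kottwitz1986, Prop. 7.1] -/
theorem forall_exists_isNormalisedOff_transport_matchingAdeleG
    (hKC : Rogawski1990.MatchingAdeleGEventuallyKConj L H)
    (hF : CompactCoreCentralizerLevelAE L 3 (Matrix.of fun i j : Fin 3 => if i.val + j.val + 1 = 3 then (1 : L) else 0))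
    {γ₀ : (cmDatum L 3 H).Rational} (hreg : Rogawski1990.IsRegularElt (γ₀.val : GL (Fin 3) L))
    {γ : (cmDatum L 3 (Matrix.of fun i j : Fin 3 => if i.val + j.val + 1 = 3 then (1 : L) else 0)).Rational}
    (hγ : Rogawski1990.Corresponds (cmConjRingHom L) H (Matrix.of fun i j : Fin 3 => if i.val + j.val + 1 = 3 then (1 : L) else 0) γ₀ γ) :
    ∀ p : Rogawski1990.MatchingAdeleG L H γ₀, ∃ S₁ : Finset (HeightOneSpectrum (𝓞 ↥(maximalRealSubfield L))),
      IsNormalisedOff L 3 (Matrix.of fun i j : Fin 3 => if i.val + j.val + 1 = 3 then (1 : L) else 0)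
        (fun v => (mG v).transport (ψ v).toMulEquiv (ψ v).continuous (ψ v).symm.continuous) p.adele S₁ :=
  fun p => exists_isNormalisedOff_transport_matchingAdeleG L H ψ hcorr' S₀ hψK νG νq hK hKq hcan hKC hF hreg hγ p

end Transport

end UnitaryGroup

end Literature.NumberTheory.Automorphic

end
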